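import Summits.AtomisticToContinuum.Crystallization.Theorems.FrustratedLawDichotomyStrainedPatchHomFloorHcpZone
import Summits.AtomisticToContinuum.Crystallization.Theorems.FrustratedLawDichotomyStrainedPatchHomSignedWell

/-!
# Aperiodic strained patch — «HomNearSocket»: the NEAR `U`-box entry of the E-piece IN ONE STEP — lens-5 g106's signed ζ-centred energy floor
# `hcpEnergy_of_ballLeaves_signed` at the RECORD window, through #46's zone-relative socket, to the `hNear` binder of #44's dispatch
# (cell decomp-a2c hand-2 g44, structural #47; critic row 1654 (S5) item 3 «one line each» typed; DEF-FREE)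

Critic row 1654 (S5) fixed the near-box glue of record as the chain
`hcpEnergy_of_ballLeaves_signed (B := record window family, SA U := unshifted family sum)` → #46 `homFloorHcp_leafBall_of_boxSum[_selfAdjoint]` (`m ≤ floor/2 − e_W`)
→ #44 `hNear`.  This file IS that chain, so that a near `U`-box enters the dispatch with exactly its three leaves and one budget inequality:

* (no §1 definitions) the `A`-family term `SA U` is written out as the filtered record box sum `Σ_{b ∈ [−7,7]³, b ≠ 0} W₄₅‖latPt U hexFrame b‖`
  (`recordBox`-free statements; the box literal `Fintype.piFinset fun _ => Finset.Icc (−7) 7` appears verbatim as in #38/#46).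
* §2 ★★★ `homFloorHcp_leafBall_of_ballLeaves_signed` — box predicate `box`, track `σ` with `‖σ U‖ ≤ 1/4` on the box, tube radius `R₀`, the three leaves of
  `hcpEnergy_of_ballLeaves_signed` at the record window (VALUE at the track `V₀ ≤ SA U + Σ_b W₄₅‖latPt U b + U(hcpShift + σ U)‖`, SLOPE at the track with constant
  `G ≥ 0`, CURVATURE-SUM floor `λ` of any sign on the ball) and the BUDGET LINE `2·(m + e_W) ≤ V₀ − G·(5R₀/4) + (min λ 0/2)·(5R₀/4)²`
  ⟹ `HomFloorHcp (box G ∧ ‖ξ − σ G‖ ≤ R₀) m` — the `hNear B` binder of #44 `homFloorHcp_of_dispatch[_graded]` / #45's consumers at `box := box B`, `σ := σf B`,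
  `R₀ := R B`; general-frame form (leaves certified for every `‖U − 1‖ ≤ 1/4` in the box).
* §3 ★★★ `homFloorHcp_leafBall_of_ballLeaves_signed_selfAdjoint` — the same with the leaves certified on SELF-ADJOINT positive `U` only (sym-entry `U`-boxes) and
  `box`, `σ` rotation-invariant (#46 §2 polar-factor socket).
* §4 the budget line at the record numbers (`m = 3/5000 + 13/50000`, `e_W = −7175/10000 + 3/400`, `R₀ = 3/400`): `2(m + e_W) = −1.41768`, so the leaves must
  deliver `V₀ − (3/320)·G + (min λ 0)·(9/204800) ≥ −1.41768` (`example`).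

One- to twelve-line proofs over TREE (144) `…HomSignedWell` + #46 `…HomFloorHcpZone`; 0 sorry; no definitions; standard axioms.
`--supports stmt-AtomisticToContinuum-27623 --as helper`.  [folklore chaining]
-/

noncomputable section

namespace Summit.AtomisticToContinuum.Crystallization.Theorems.FrustratedLawDichotomyStrainedPatchHomNearSocket

open scoped BigOperators
open Summit.AtomisticToContinuum.Crystallization.Theorems.ChargedEnergyGapNegative (E3)
open Summit.AtomisticToContinuum.Crystallization.Theorems.FrustratedLawDichotomySchurCut (effPot w₄₅ ω₄)
open Summit.AtomisticToContinuum.Crystallization.Theorems.FrustratedLawDichotomyStrainedPatchTaylorChord (segR segG segGd)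
open Summit.AtomisticToContinuum.Crystallization.Theorems.FrustratedLawDichotomyStrainedPatchHomSplit (latPt hexFrame hcpShift)
open Summit.AtomisticToContinuum.Crystallization.Theorems.FrustratedLawDichotomyStrainedPatchTaylorLeaves (junctions)
open Summit.AtomisticToContinuum.Crystallization.Theorems.FrustratedLawDichotomyStrainedPatchHomXiWindow (HomFloorHcp)
open Summit.AtomisticToContinuum.Crystallization.Theorems.FrustratedLawDichotomyStrainedPatchHomSignedWell (hcpEnergy_of_ballLeaves_signed)
open Summit.AtomisticToContinuum.Crystallization.Theorems.FrustratedLawDichotomyStrainedPatchHomFloorHcpZone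

/-! ## §2. The near socket, general frame -/

section General

variable {box : (E3 →L[ℝ] E3) → Prop} {σ : (E3 →L[ℝ] E3) → E3} {R₀ lam G V₀ m : ℝ}

/-- ★★★ **NEAR `U`-BOX ENTRY IN ONE STEP** (critic row 1654 (S5) item 3): the three ζ-centred leaves of `hcpEnergy_of_ballLeaves_signed` at the RECORD window
`[−7,7]³` with the `A`-family term the unshifted filtered sum, the track inside the quarter ball on the box, and the budget line
`2(m + e_W) ≤ V₀ − G·(5R₀/4) + (min λ 0/2)(5R₀/4)²` ⟹ the `hNear` binder `HomFloorHcp (box G ∧ ‖ξ − σ G‖ ≤ R₀) m` of #44's dispatch.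
[folklore chaining: (144) `hcpEnergy_of_ballLeaves_signed` + #46 `homFloorHcp_leafBall_of_boxSum`] -/
theorem homFloorHcp_leafBall_of_ballLeaves_signed (hG₀ : 0 ≤ G)
    (hσ : ∀ U : E3 →L[ℝ] E3, box U → ‖U - 1‖ ≤ 1 / 4 → ‖σ U‖ ≤ 1 / 4)
    (hval : ∀ U : E3 →L[ℝ] E3, box U → ‖U - 1‖ ≤ 1 / 4 → ‖σ U‖ ≤ 1 / 4 →
      V₀ ≤ (∑ b ∈ (Fintype.piFinset fun _ : Fin 3 => Finset.Icc (-7 : ℤ) 7).filter (fun b => b ≠ 0), effPot w₄₅ ω₄ (3 / 400) ‖latPt U hexFrame b‖) +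
        ∑ b ∈ (Fintype.piFinset fun _ : Fin 3 => Finset.Icc (-7 : ℤ) 7), effPot w₄₅ ω₄ (3 / 400) ‖latPt U hexFrame b + U (hcpShift + σ U)‖)
    (hslope : ∀ (U : E3 →L[ℝ] E3) (ξ : E3), box U → ‖U - 1‖ ≤ 1 / 4 → ‖σ U‖ ≤ 1 / 4 →
      |∑ b ∈ (Fintype.piFinset fun _ : Fin 3 => Finset.Icc (-7 : ℤ) 7),
          segG (deriv (effPot w₄₅ ω₄ (3 / 400))) (latPt U hexFrame b + U (hcpShift + σ U)) (U (ξ - σ U)) 0| ≤ G * ‖U (ξ - σ U)‖)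
    (hcurv : ∀ (U : E3 →L[ℝ] E3) (ξ : E3), box U → ‖U - 1‖ ≤ 1 / 4 → ‖σ U‖ ≤ 1 / 4 → ‖ξ - σ U‖ ≤ R₀ → ‖ξ‖ ≤ 1 / 4 →
      ∀ s ∈ Set.Ioo (0 : ℝ) 1, (∀ b ∈ (Fintype.piFinset fun _ : Fin 3 => Finset.Icc (-7 : ℤ) 7),
          segR (latPt U hexFrame b + U (hcpShift + σ U)) (U (ξ - σ U)) s ∉ junctions) →
        lam * ‖U (ξ - σ U)‖ ^ 2 ≤ ∑ b ∈ (Fintype.piFinset fun _ : Fin 3 => Finset.Icc (-7 : ℤ) 7),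
          segGd (deriv (effPot w₄₅ ω₄ (3 / 400))) (latPt U hexFrame b + U (hcpShift + σ U)) (U (ξ - σ U)) s)
    (hm : 2 * (m + (-(7175 / 10000) + 3 / 400)) ≤ V₀ - G * (5 / 4 * R₀) + min lam 0 / 2 * (5 / 4 * R₀) ^ 2) :
    HomFloorHcp (fun G ξ => box G ∧ ‖ξ - σ G‖ ≤ R₀) m := by
  refine homFloorHcp_leafBall_of_boxSum fun U ξ hU hξ hB hr => ?_
  have key := hcpEnergy_of_ballLeaves_signed (Fintype.piFinset fun _ : Fin 3 => Finset.Icc (-7 : ℤ) 7) box σ hG₀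
    (fun U => ∑ b ∈ (Fintype.piFinset fun _ : Fin 3 => Finset.Icc (-7 : ℤ) 7).filter (fun b => b ≠ 0), effPot w₄₅ ω₄ (3 / 400) ‖latPt U hexFrame b‖)
    hval hslope hcurv U hB hU (hσ U hB hU) ξ hr hξ
  linarith

end General

/-! ## §3. The near socket, polar-factor form -/

section Polar

variable {box : (E3 →L[ℝ] E3) → Prop} {σ : (E3 →L[ℝ] E3) → E3} {R₀ lam G V₀ m : ℝ}

/-- ★★★ **NEAR `U`-BOX ENTRY, LEAVES ON SELF-ADJOINT `U` ONLY** (sym-entry `U`-boxes): `box` and `σ` rotation-invariant, the three leaves certified for every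
self-adjoint positive `U` with `‖U − 1‖ ≤ 1/4` in the box, the budget line ⟹ the `hNear` binder. [folklore chaining: (144) + #46 `homFloorHcp_leafBall_of_boxSum_selfAdjoint`] -/
theorem homFloorHcp_leafBall_of_ballLeaves_signed_selfAdjoint (hG₀ : 0 ≤ G)
    (hbox : ∀ (R : E3 ≃ₗᵢ[ℝ] E3) (U : E3 →L[ℝ] E3), box ((R : E3 →L[ℝ] E3).comp U) → box U)
    (hσR : ∀ (R : E3 ≃ₗᵢ[ℝ] E3) (U : E3 →L[ℝ] E3), σ ((R : E3 →L[ℝ] E3).comp U) = σ U)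
    (hσ : ∀ U : E3 →L[ℝ] E3, (∀ v w : E3, inner ℝ (U v) w = inner ℝ v (U w)) → (∀ w : E3, 0 ≤ inner ℝ w (U w)) → box U → ‖U - 1‖ ≤ 1 / 4 →
      ‖σ U‖ ≤ 1 / 4)
    (hval : ∀ U : E3 →L[ℝ] E3, (∀ v w : E3, inner ℝ (U v) w = inner ℝ v (U w)) → (∀ w : E3, 0 ≤ inner ℝ w (U w)) → box U → ‖U - 1‖ ≤ 1 / 4 →
      ‖σ U‖ ≤ 1 / 4 →
      V₀ ≤ (∑ b ∈ (Fintype.piFinset fun _ : Fin 3 => Finset.Icc (-7 : ℤ) 7).filter (fun b => b ≠ 0), effPot w₄₅ ω₄ (3 / 400) ‖latPt U hexFrame b‖) +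
        ∑ b ∈ (Fintype.piFinset fun _ : Fin 3 => Finset.Icc (-7 : ℤ) 7), effPot w₄₅ ω₄ (3 / 400) ‖latPt U hexFrame b + U (hcpShift + σ U)‖)
    (hslope : ∀ (U : E3 →L[ℝ] E3) (ξ : E3), (∀ v w : E3, inner ℝ (U v) w = inner ℝ v (U w)) → (∀ w : E3, 0 ≤ inner ℝ w (U w)) → box U →
      ‖U - 1‖ ≤ 1 / 4 → ‖σ U‖ ≤ 1 / 4 →
      |∑ b ∈ (Fintype.piFinset fun _ : Fin 3 => Finset.Icc (-7 : ℤ) 7),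
          segG (deriv (effPot w₄₅ ω₄ (3 / 400))) (latPt U hexFrame b + U (hcpShift + σ U)) (U (ξ - σ U)) 0| ≤ G * ‖U (ξ - σ U)‖)
    (hcurv : ∀ (U : E3 →L[ℝ] E3) (ξ : E3), (∀ v w : E3, inner ℝ (U v) w = inner ℝ v (U w)) → (∀ w : E3, 0 ≤ inner ℝ w (U w)) → box U →
      ‖U - 1‖ ≤ 1 / 4 → ‖σ U‖ ≤ 1 / 4 → ‖ξ - σ U‖ ≤ R₀ → ‖ξ‖ ≤ 1 / 4 →
      ∀ s ∈ Set.Ioo (0 : ℝ) 1, (∀ b ∈ (Fintype.piFinset fun _ : Fin 3 => Finset.Icc (-7 : ℤ) 7),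
          segR (latPt U hexFrame b + U (hcpShift + σ U)) (U (ξ - σ U)) s ∉ junctions) →
        lam * ‖U (ξ - σ U)‖ ^ 2 ≤ ∑ b ∈ (Fintype.piFinset fun _ : Fin 3 => Finset.Icc (-7 : ℤ) 7),
          segGd (deriv (effPot w₄₅ ω₄ (3 / 400))) (latPt U hexFrame b + U (hcpShift + σ U)) (U (ξ - σ U)) s)
    (hm : 2 * (m + (-(7175 / 10000) + 3 / 400)) ≤ V₀ - G * (5 / 4 * R₀) + min lam 0 / 2 * (5 / 4 * R₀) ^ 2) :
    HomFloorHcp (fun G ξ => box G ∧ ‖ξ - σ G‖ ≤ R₀) m := by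
  refine homFloorHcp_leafBall_of_boxSum_selfAdjoint hbox hσR fun U ξ hsa hpos hU hξ hB hr => ?_
  -- the three leaves restricted to this self-adjoint `U`, packaged for `hcpEnergy_of_ballLeaves_signed` on the one-point box `{U}`
  have key := hcpEnergy_of_ballLeaves_signed (Fintype.piFinset fun _ : Fin 3 => Finset.Icc (-7 : ℤ) 7) (fun U' => U' = U) σ hG₀
    (fun U => ∑ b ∈ (Fintype.piFinset fun _ : Fin 3 => Finset.Icc (-7 : ℤ) 7).filter (fun b => b ≠ 0), effPot w₄₅ ω₄ (3 / 400) ‖latPt U hexFrame b‖)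
    (fun U' hU' hU1 hσ1 => by subst hU'; exact hval U' hsa hpos hB hU1 hσ1)
    (fun U' ξ' hU' hU1 hσ1 => by subst hU'; exact hslope U' ξ' hsa hpos hB hU1 hσ1)
    (fun U' ξ' hU' hU1 hσ1 hr' hξ' => by subst hU'; exact hcurv U' ξ' hsa hpos hB hU1 hσ1 hr' hξ')
    U rfl hU (hσ U hsa hpos hB hU) ξ hr hξ
  linarith

end Polar

/-! ## §4. The budget line at the record numbers -/

/-- At `m = 3/5000 + 13/50000`, `e_W = −7175/10000 + 3/400`, `R₀ = 3/400`: `2(m + e_W) = −1.41768` and `(5R₀/4)² /2 = 9/204800`, so the budget line reads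
`V₀ − (3/320)·G + (min λ 0)·(9/204800) ≥ −1.41768`; e.g. `V₀ = −1.4170`, `G = 9/200`, `λ = −231/200` passes. [arithmetic] -/
example : 2 * ((3 / 5000 + 13 / 50000 : ℝ) + (-(7175 / 10000) + 3 / 400)) ≤
    (-14170 / 10000 : ℝ) - (9 / 200) * (5 / 4 * (3 / 400)) + min (-(231 / 200 : ℝ)) 0 / 2 * (5 / 4 * (3 / 400)) ^ 2 := by
  rw [min_eq_left (by norm_num)]; norm_num

/-! ## §5. (append, hand-2 g44) The FAR `U`-box entry: a VALUE leaf on the product box -/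

section Far

variable {box : (E3 →L[ℝ] E3) → Prop} {a b : Fin 3 → ℝ} {V₀ m : ℝ}

/-- ★★★ **FAR `U`-BOX ENTRY IN ONE STEP**: a VALUE leaf uniform over the PRODUCT box — for every admissible `U` in the box and every `ξ` in the ξ-box
`|ξ_i − a_i| ≤ b_i` (`‖ξ‖ ≤ 1/4`), `V₀ ≤ SA U + Σ_b W₄₅‖latPt U hexFrame b + U(hcpShift + ξ)‖` at the record window with `SA U` the unshifted filtered sum —
and the budget line `2(m + e_W) ≤ V₀` ⟹ `HomFloorHcp (box G ∧ ∀ i, |ξ_i − a_i| ≤ b_i) m` = the floor half of the `hFar B` binder of #44's dispatch (the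
containment half `r + |σf B G i − a_i| ≤ b_i` is separate, #44 §2). [#46 `homFloorHcp_productBox_of_boxSum` + linarith] -/
theorem homFloorHcp_productBox_of_valueLeaf
    (hval : ∀ (U : E3 →L[ℝ] E3) (ξ : E3), box U → ‖U - 1‖ ≤ 1 / 4 → (∀ i, |ξ i - a i| ≤ b i) → ‖ξ‖ ≤ 1 / 4 →
      V₀ ≤ (∑ b ∈ (Fintype.piFinset fun _ : Fin 3 => Finset.Icc (-7 : ℤ) 7).filter (fun b => b ≠ 0), effPot w₄₅ ω₄ (3 / 400) ‖latPt U hexFrame b‖) +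
        ∑ b ∈ (Fintype.piFinset fun _ : Fin 3 => Finset.Icc (-7 : ℤ) 7), effPot w₄₅ ω₄ (3 / 400) ‖latPt U hexFrame b + U (hcpShift + ξ)‖)
    (hm : 2 * (m + (-(7175 / 10000) + 3 / 400)) ≤ V₀) : HomFloorHcp (fun G ξ => box G ∧ ∀ i, |ξ i - a i| ≤ b i) m :=
  homFloorHcp_productBox_of_boxSum fun U ξ hU hξ hB hbox => by have h := hval U ξ hB hU hbox hξ; linarith

/-- ★★★ **FAR `U`-BOX ENTRY, VALUE LEAF ON SELF-ADJOINT `U` ONLY** (`box` rotation-invariant; the census value leaf `t2ReportL` runs on sym-entry `U`-boxes).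
[#46 `homFloorHcp_productBox_of_boxSum_selfAdjoint` + linarith] -/
theorem homFloorHcp_productBox_of_valueLeaf_selfAdjoint
    (hbox : ∀ (R : E3 ≃ₗᵢ[ℝ] E3) (U : E3 →L[ℝ] E3), box ((R : E3 →L[ℝ] E3).comp U) → box U)
    (hval : ∀ (U : E3 →L[ℝ] E3) (ξ : E3), (∀ v w : E3, inner ℝ (U v) w = inner ℝ v (U w)) → (∀ w : E3, 0 ≤ inner ℝ w (U w)) → box U →
      ‖U - 1‖ ≤ 1 / 4 → (∀ i, |ξ i - a i| ≤ b i) → ‖ξ‖ ≤ 1 / 4 →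
      V₀ ≤ (∑ b ∈ (Fintype.piFinset fun _ : Fin 3 => Finset.Icc (-7 : ℤ) 7).filter (fun b => b ≠ 0), effPot w₄₅ ω₄ (3 / 400) ‖latPt U hexFrame b‖) +
        ∑ b ∈ (Fintype.piFinset fun _ : Fin 3 => Finset.Icc (-7 : ℤ) 7), effPot w₄₅ ω₄ (3 / 400) ‖latPt U hexFrame b + U (hcpShift + ξ)‖)
    (hm : 2 * (m + (-(7175 / 10000) + 3 / 400)) ≤ V₀) : HomFloorHcp (fun G ξ => box G ∧ ∀ i, |ξ i - a i| ≤ b i) m :=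
  homFloorHcp_productBox_of_boxSum_selfAdjoint hbox fun U ξ hsa hpos hU hξ hB hbox' => by
    have h := hval U ξ hsa hpos hB hU hbox' hξ; linarith

end Far

end Summit.AtomisticToContinuum.Crystallization.Theorems.FrustratedLawDichotomyStrainedPatchHomNearSocket

end
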